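import Literature.MathematicalPhysics.QuantumLattice.HubbardOpenBoxCodedClusterRows
import HarnessLib

/-!
# Data-free kernel exact-diagonalisation floors of a GENERAL coded cluster: the checker and its soundness

Topic `MathematicalPhysics/QuantumLattice`, family `hubbard`. The generic form of
`HubbardOpenBoxEDCertificateKronecker` (in-kernel fixed-point Cholesky with Kronecker-substitution dot
products, checked as a packed rounded Gram certificate — Rump 2006 §2 / Blekherman–Parrilo–Thomas
App. A.1.2; the finite-precision shift of a numerical dual certificate is Kull–Schuch–Dive–Navascués 2024
§5.3): the packed matrix rows are produced by a **coded cluster oracle** `O : CodedCluster`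
(`HubbardOpenBoxCodedClusterRows`: `O.rowsA`, `entry_rowA`) instead of the uniform `t–t'` row builder;
the untrusted factoriser `factorRows`, the residual walk `ddAllN` and the packed-row arithmetic
(`PSD.Packed`) are the tree's, unchanged.

* §1 **`KCert.checkG C O a b p q Q L`** — the one Boolean the kernel decides for the spin sector `(p, q)`
  (sector code list `L` checked by `sectorListOK`, rank table, no-carry bounds against `O.bound`, peel of
  every factor row, diagonal dominance of every residual row), and `KCert.factorOfG`.
* §2 soundness: `isGramCertZ_of_checkG` (a passing check is an integer rounded Gram certificate
  `PSD.IsGramCertZ` for the block `K·(hz − c·1)` along `L` — symmetry of the block is PROVED from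
  `O.Models`, not checked) and **`KCert.soundG`**: if `O.Models a b hz Q H` and `checkG = true` then
  `(c/Q)·‖v‖² ≤ re ⟨v, H v⟩` for every `v` supported in the spin sector `(p, q)`.

The assembly over the sectors of a particle number (`groundEnergy_ge_of_kCertsG/G₂/G₃`) and the row-block
pieces are in `HubbardOpenBoxCodedClusterCertificateBlocks`. Everything is proved; no named fact; nothing
numerical is asserted here.

## References

* S. M. Rump, BIT 46 (2006) 433, §2 (rounded Cholesky + residual bound). [cite: Rump2006PosDef, §2]
* G. Blekherman, P. Parrilo, R. Thomas (eds.), SIAM 2012, App. A.1.2 (rounded Gram certificates).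
  [cite: BlekhermanParriloThomas2012, App. A.1.2]
* D. Harvey, J. Symb. Comput. 44 (2009) 1502, §3.1 (Kronecker substitution). [cite: Harvey2009, §3.1]
* I. Kull, N. Schuch, B. Dive, M. Navascués, PRX 14 (2024) 021008, §5.3. [cite: KullEtAl2024, §5.3]
* H. Q. Lin, J. E. Gubernatis, Comput. Phys. 7 (1993) 400, §II. [cite: LinGubernatis1993, §II]
-/

namespace Literature.MathematicalPhysics.QuantumLattice

namespace OccupationCode

open Finset Matrix Literature.Computation.Certificates Literature.Computation.Certificates.PSD
  Literature.Computation.Certificates.PSD.Packed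

/-! ### §1 The generic checker -/

namespace KCert

variable (C : KCert)

/-- The factor rows computed by the kernel for the sector code list `L` from the oracle's packed rows
(untrusted data). [cite: Rump2006PosDef, §2] -/
def factorOfG (O : CodedCluster) (L : List ℕ) : List Row :=
  let n := L.length
  let RAs := O.rowsA C.K C.c C.y (2 ^ (C.y - 1)) (geomNat (2 ^ C.y) n) (rankTab L 0) L 0
  (factorRows C.y C.x (C.x * (n - 1)) C.O (2 ^ (C.y - 1)) C.D n RAs 0 []).map FRow.row

/-- The oracle's packed matrix rows of the sector code list `L` (as inside `checkG`). [cite: LinGubernatis1993, §II] -/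
def rowsOfG (O : CodedCluster) (L : List ℕ) : List ℕ :=
  O.rowsA C.K C.c C.y (2 ^ (C.y - 1)) (geomNat (2 ^ C.y) L.length) (rankTab L 0) L 0

/-- **THE GENERIC KERNEL CHECKER** of a data-free certificate for the spin sector `(p, q)` of the open
`a × b` cluster described by the coded oracle `O` (entries `hz/Q`), with supplied code list `L`: the list
enumerates the sector (`sectorListOK`) and its rank table is right, the packed-row fields cannot carry
(`K·(O.bound + |c|) < 2^{y-1}`), the factor computed by the kernel passes the packed rounded Gram check
(peel, no-carry bound, diagonal dominance of every residual row). Discharge by `decide +kernel`.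
[cite: BlekhermanParriloThomas2012, App. A.1.2] [cite: Rump2006PosDef, §2] -/
def checkG (O : CodedCluster) (a b p q Q : ℕ) (L : List ℕ) : Bool :=
  let n := L.length
  let X := 2 ^ C.x
  let OA := 2 ^ (C.y - 1)
  let RT := rankTab L 0
  let RAs := O.rowsA C.K C.c C.y OA (geomNat (2 ^ C.y) n) RT L 0
  let P := C.factorOfG O L
  decide (0 < Q) && decide (0 < C.K) && decide (1 ≤ C.y) && sectorListOK a b p q L && rankOK RT L 0 &&
    decide (C.K * (O.bound + C.c.natAbs) < OA) &&
    (P.length == n) && P.all (fun r => peelOK X (2 * C.O) (List.replicate n 1) r.p 0 0 r.r r.t) &&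
    decide (n * (2 * C.O) ^ 2 < X) &&
    ddAllN C.y C.x (C.x * (n - 1)) C.O OA n P 0 RAs P

end KCert

/-! ### §2 Soundness -/

section Sound

variable {a b : ℕ}

/-- `getD` on a list of ones. [folklore] -/
private theorem getD_replicate_one' {n k : ℕ} (hk : k < n) : (List.replicate n 1).getD k 0 = 1 := by
  rw [List.getD_eq_getElem?_getD, List.getElem?_replicate, if_pos hk]
  rfl

/-- `|P − M|` as the `natAbs` of the integer difference. [folklore] -/
private theorem natAbs_sub_cast' (P M : ℕ) : ((P : ℤ) - (M : ℤ)).natAbs = absDiff P M := by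
  unfold absDiff
  split_ifs with h
  · rw [← Nat.cast_sub h, Int.natAbs_natCast]
  · rw [show (P : ℤ) - M = -((M : ℤ) - P) by ring, Int.natAbs_neg, ← Nat.cast_sub (le_of_not_ge h),
      Int.natAbs_natCast]

/-- The residual entry from its two nonnegative parts: matrix field + `O(t_i + t_j)` against offset + middle
digit + `O² n`. [cite: BlekhermanParriloThomas2012, App. A.1.2] -/
private theorem entry_sub_wdot' (y x n O RA j : ℕ) (qi qj : Row) :
    entry y RA j - wdot (2 ^ x) ((2 ^ x) ^ (n - 1)) O n qi qj =
      (((RA >>> (y * j)) % 2 ^ y + O * (qi.t + qj.t) : ℕ) : ℤ) -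
        ((2 ^ (y - 1) + midDig x (x * (n - 1)) (qi.p * qj.r) + O * O * n : ℕ) : ℤ) := by
  rw [entry, wdot, ← midDig_eq]
  push_cast
  ring

/-- Semantics of `rowLoop`: on success the accumulated absolute row sum stays within the budget. [folklore] -/
private theorem rowLoop_spec' (y x sh O OA n RA : ℕ) (qi : Row) (D2 : ℕ) :
    ∀ (qs : List Row) (j acc : ℕ), rowLoop y x sh O OA n RA qi D2 qs j acc = true →
      acc + ∑ k ∈ range qs.length, absDiff ((RA >>> (y * (j + k))) % 2 ^ y + O * (qi.t + (qs.getD k ⟨0, 0, 0⟩).t))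
        (OA + midDig x sh (qi.p * (qs.getD k ⟨0, 0, 0⟩).r) + O * O * n) ≤ D2
  | [], j, acc, h => by
      rw [rowLoop, decide_eq_true_eq] at h
      rw [List.length_nil, Finset.sum_range_zero, add_zero]
      exact h
  | qj :: qs, j, acc, h => by
      rw [rowLoop, Bool.and_eq_true, Bool.not_eq_eq_eq_not, Bool.not_true, decide_eq_false_iff_not,
        not_lt] at h
      obtain ⟨_, h2⟩ := h
      have ih := rowLoop_spec' y x sh O OA n RA qi D2 qs (j + 1) _ h2
      rw [List.length_cons, Finset.sum_range_succ']
      simp only [List.getD_cons_zero, List.getD_cons_succ, add_zero]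
      rw [Finset.sum_congr rfl fun k _ => by rw [show j + (k + 1) = j + 1 + k by omega]]
      linarith

/-- Semantics of `rowOK`: the diagonal parts are ordered and the whole absolute row sum is at most twice the
diagonal entry. [folklore] -/
private theorem rowOK_spec' {y x sh O OA n RA i : ℕ} {qi : Row} {P : List Row}
    (h : rowOK y x sh O OA n RA qi i P = true) :
    OA + midDig x sh (qi.p * qi.r) + O * O * n ≤ (RA >>> (y * i)) % 2 ^ y + O * (qi.t + qi.t) ∧
    ∑ k ∈ range P.length, absDiff ((RA >>> (y * k)) % 2 ^ y + O * (qi.t + (P.getD k ⟨0, 0, 0⟩).t))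
        (OA + midDig x sh (qi.p * (P.getD k ⟨0, 0, 0⟩).r) + O * O * n) ≤
      2 * ((RA >>> (y * i)) % 2 ^ y + O * (qi.t + qi.t) - (OA + midDig x sh (qi.p * qi.r) + O * O * n)) := by
  simp only [rowOK, Bool.and_eq_true, decide_eq_true_eq] at h
  refine ⟨h.1, ?_⟩
  have := rowLoop_spec' y x sh O OA n RA qi _ P 0 0 h.2
  simpa using this

/-- Semantics of the residual walk `ddAllN`: every row from `i₀` on passes `rowOK` (the diagonal-dominance test of a
rounded Gram certificate, row by row). [cite: BlekhermanParriloThomas2012, App. A.1.2] -/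
theorem ddAllN_spec' (y x sh O OA n : ℕ) (P : List Row) :
    ∀ (i₀ : ℕ) (RAs : List ℕ) (qs : List Row), RAs.length = qs.length → ddAllN y x sh O OA n P i₀ RAs qs = true →
      ∀ k < qs.length, rowOK y x sh O OA n (RAs.getD k 0) (qs.getD k ⟨0, 0, 0⟩) (i₀ + k) P = true
  | _, [], [], _, _, k, hk => by simp at hk
  | _, [], _ :: _, hl, _, _, _ => by simp at hl
  | _, _ :: _, [], hl, _, _, _ => by simp at hl
  | i₀, RA :: RAs, qi :: qs, hl, h, k, hk => by
      simp only [ddAllN, Bool.and_eq_true] at h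
      cases k with
      | zero => simpa using h.1
      | succ k =>
          have := ddAllN_spec' y x sh O OA n P (i₀ + 1) RAs qs (by simpa using hl) h.2 k (by simpa using hk)
          simpa [add_assoc, add_comm 1 k] using this

/-- The integer block of the spin sector along the code list `L` for the coded entries `hz`:
`A i j = K·(hz L[i] L[j] − c·δ_ij)`. [cite: LinGubernatis1993, §II] -/
def blockAG (hz : ℕ → ℕ → ℤ) (K : ℕ) (c : ℤ) (L : List ℕ) : Matrix (Fin L.length) (Fin L.length) ℤ :=
  fun i j => (K : ℤ) * (hz L[i] L[j] - if i = j then c else 0)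

variable {O : CodedCluster} {hz : ℕ → ℕ → ℤ} {Q : ℕ}
  {H : Matrix (Finset (Orb (Fin a ×ₗ Fin b))) (Finset (Orb (Fin a ×ₗ Fin b))) ℂ}

/-- **Soundness (reduction)**: under `O.Models a b hz Q H`, a passing generic check is an integer rounded Gram
certificate `PSD.IsGramCertZ` for the block `A = K·(hz − c·1)` along `L`, the unit weights and the factor
decoded from the kernel-computed packings. [cite: BlekhermanParriloThomas2012, App. A.1.2] [cite: Rump2006PosDef, §2] -/
theorem isGramCertZ_of_checkG (C : KCert) (hM : O.Models a b hz Q H) {p q : ℕ} {L : List ℕ}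
    (h : C.checkG O a b p q Q L = true) :
    IsGramCertZ (blockAG hz C.K C.c L) (weights (List.replicate L.length 1))
      (factor C.x C.O (List.replicate L.length 1) (C.factorOfG O L) L.length) := by
  have hX : 0 < 2 ^ C.x := Nat.two_pow_pos C.x
  simp only [KCert.checkG, Bool.and_eq_true, decide_eq_true_eq, beq_iff_eq, List.all_eq_true] at h
  obtain ⟨⟨⟨⟨⟨⟨⟨⟨⟨hQ, _⟩, hy⟩, hL⟩, hRT⟩, hKO⟩, hlen⟩, hpeel⟩, hbound⟩, hdd⟩ := h
  set n := L.length with hn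
  set P := C.factorOfG O L with hP
  set RAs := O.rowsA C.K C.c C.y (2 ^ (C.y - 1)) (geomNat (2 ^ C.y) L.length) (rankTab L 0) L 0 with hRAs
  have hpeel' : ∀ i < n, peelOK (2 ^ C.x) (2 * C.O) (List.replicate n 1) (rowOf P i).p 0 0 (rowOf P i).r
      (rowOf P i).t = true := by
    intro i hi
    have hmem : rowOf P i ∈ P := by
      simp only [rowOf, List.getD_eq_getElem?_getD]
      rw [List.getElem?_eq_getElem (by omega)]
      exact List.getElem_mem _
    exact hpeel _ hmem
  -- the matrix entries read from the packed rows
  have hRA : ∀ i : Fin L.length, RAs.getD i 0 =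
      O.rowA C.K C.c C.y (2 ^ (C.y - 1)) (geomNat (2 ^ C.y) L.length) (rankTab L 0) L[i] i := by
    intro i
    rw [hRAs, O.getD_rowsA C.K C.c _ _ _ _ L 0 i i.isLt, zero_add]
    simp only [Fin.getElem_fin]
  have hentry : ∀ i j : Fin L.length, entry C.y (RAs.getD i 0) j = blockAG hz C.K C.c L i j := by
    intro i j
    rw [hRA i, CodedCluster.entry_rowA hM hQ hL hy hRT hKO i j]
    rfl
  -- the residual entries
  have hres : ∀ i j : Fin L.length,
      gramResidualZ (blockAG hz C.K C.c L) (weights (List.replicate n 1))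
        (factor C.x C.O (List.replicate n 1) P n) i j =
      entry C.y (RAs.getD i 0) j - wdot (2 ^ C.x) ((2 ^ C.x) ^ (n - 1)) C.O n (rowOf P i) (rowOf P j) := by
    intro i j
    rw [wdot_eq_sum (hpeel' i i.isLt) (hpeel' j j.isLt) hbound, hentry, gramResidualZ]
    congr 1
    have hw : ∀ k : Fin (List.replicate n 1).length, (weights (List.replicate n 1) k : ℤ) = 1 := by
      intro k
      rw [weights, getD_replicate_one' (by simpa using k.isLt)]
      rfl
    simp only [hw, one_mul, factor]
    rw [Fin.sum_univ_eq_sum_range (fun k => ((((dig (2 ^ C.x) (rowOf P i).p k : ℕ) : ℤ) - C.O) *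
      (((dig (2 ^ C.x) (rowOf P j).p k : ℕ) : ℤ) - C.O))) (List.replicate n 1).length, List.length_replicate]
  refine IsDiagDominantZ.intro (fun i j => ?_) (fun i => ?_)
  · -- symmetry (proved, not checked)
    simp only [gramResidualZ, blockAG]
    have hij : hz L[i] L[j] = hz L[j] L[i] := by
      have hci : code (decode L[i] : Finset (Orb (Fin a ×ₗ Fin b))) = L[i] :=
        code_decode (lt_of_mem_of_ok hL (List.getElem_mem i.isLt))
      have hcj : code (decode L[j] : Finset (Orb (Fin a ×ₗ Fin b))) = L[j] :=
        code_decode (lt_of_mem_of_ok hL (List.getElem_mem j.isLt))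
      have := hM.symm (decode L[i]) (decode L[j])
      rwa [hci, hcj] at this
    rw [hij]
    by_cases hij' : i = j
    · subst hij'; rfl
    · rw [if_neg hij', if_neg (Ne.symm hij')]
      congr 1
      exact Finset.sum_congr rfl fun k _ => by ring
  · -- row `i` diagonal dominance
    set M := gramResidualZ (blockAG hz C.K C.c L) (weights (List.replicate n 1))
      (factor C.x C.O (List.replicate n 1) P n) with hM'
    have hlenRA : RAs.length = P.length := by rw [hRAs, O.length_rowsA, hlen]
    have hrow := ddAllN_spec' C.y C.x (C.x * (n - 1)) C.O (2 ^ (C.y - 1)) n P 0 RAs P hlenRA hdd i (by omega)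
    simp only [zero_add] at hrow
    obtain ⟨hdiag, hsum⟩ := rowOK_spec' hrow
    rw [hlen] at hsum
    have hMij : ∀ j : Fin L.length, M i j =
        (((RAs.getD i 0 >>> (C.y * (j : ℕ))) % 2 ^ C.y + C.O * ((rowOf P i).t + (rowOf P j).t) : ℕ) : ℤ) -
          ((2 ^ (C.y - 1) + midDig C.x (C.x * (n - 1)) ((rowOf P i).p * (rowOf P j).r) + C.O * C.O * n : ℕ) : ℤ) := by
      intro j
      rw [hres i j, entry_sub_wdot']
    have hMabs : ∀ j : Fin L.length, |M i j| =
        (absDiff ((RAs.getD i 0 >>> (C.y * (j : ℕ))) % 2 ^ C.y + C.O * ((rowOf P i).t + (rowOf P j).t))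
          (2 ^ (C.y - 1) + midDig C.x (C.x * (n - 1)) ((rowOf P i).p * (rowOf P j).r) + C.O * C.O * n) : ℤ) := by
      intro j
      rw [← Int.natCast_natAbs, hMij, natAbs_sub_cast']
    have hdiagR : 2 ^ (C.y - 1) + midDig C.x (C.x * (n - 1)) ((rowOf P i).p * (rowOf P i).r) + C.O * C.O * n ≤
        (RAs.getD i 0 >>> (C.y * (i : ℕ))) % 2 ^ C.y + C.O * ((rowOf P i).t + (rowOf P i).t) := hdiag
    have h2 : 0 ≤ M i i := by
      have : ((2 ^ (C.y - 1) + midDig C.x (C.x * (n - 1)) ((rowOf P i).p * (rowOf P i).r) + C.O * C.O * n : ℕ) : ℤ) ≤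
          (((RAs.getD i 0 >>> (C.y * (i : ℕ))) % 2 ^ C.y + C.O * ((rowOf P i).t + (rowOf P i).t) : ℕ) : ℤ) := by
        exact_mod_cast hdiagR
      rw [hMij i]; linarith
    have hsum' : ((∑ k ∈ range n, absDiff ((RAs.getD i 0 >>> (C.y * k)) % 2 ^ C.y + C.O * ((rowOf P i).t + (rowOf P k).t))
        (2 ^ (C.y - 1) + midDig C.x (C.x * (n - 1)) ((rowOf P i).p * (rowOf P k).r) + C.O * C.O * n) : ℕ) : ℤ) ≤
        ((2 * ((RAs.getD i 0 >>> (C.y * (i : ℕ))) % 2 ^ C.y + C.O * ((rowOf P i).t + (rowOf P i).t) -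
          (2 ^ (C.y - 1) + midDig C.x (C.x * (n - 1)) ((rowOf P i).p * (rowOf P i).r) + C.O * C.O * n)) : ℕ) : ℤ) := by
      exact_mod_cast hsum
    have h1 : ∑ j : Fin n, |M i j| ≤ 2 * M i i := by
      rw [Finset.sum_congr rfl fun j _ => hMabs j,
        ← Finset.sum_range (fun k => (absDiff ((RAs.getD i 0 >>> (C.y * k)) % 2 ^ C.y + C.O * ((rowOf P i).t + (rowOf P k).t))
          (2 ^ (C.y - 1) + midDig C.x (C.x * (n - 1)) ((rowOf P i).p * (rowOf P k).r) + C.O * C.O * n) : ℤ)),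
        hMij i]
      rw [Nat.cast_sum, Nat.cast_mul, Nat.cast_sub hdiagR, Nat.cast_ofNat] at hsum'
      exact hsum'
    rw [Finset.sum_erase_eq_sub (Finset.mem_univ i), abs_of_nonneg h2]
    linarith

namespace KCert

variable (C : KCert) {p q : ℕ} {L : List ℕ}

/-- **SOUNDNESS of the generic data-free kernel checker.** If `O.Models a b hz Q H` and
`C.checkG O a b p q Q L = true`, then for every Fock vector `v` supported in the spin sector `(N↑, N↓) = (p, q)`
of the open `a × b` cluster, `(c/Q) · ‖v‖² ≤ re ⟨v, H v⟩`. [cite: KullEtAl2024, §5.3] [cite: Rump2006PosDef, §2] -/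
theorem soundG (hM : O.Models a b hz Q H) (h : C.checkG O a b p q Q L = true) (v : Fock (Orb (Fin a ×ₗ Fin b)))
    (hv : ∀ s, ¬((upPart s).card = p ∧ (downPart s).card = q) → v s = 0) :
    ((C.floor Q : ℚ) : ℝ) * (star v ⬝ᵥ v).re ≤ (star v ⬝ᵥ (H *ᵥ v)).re := by
  have hG := isGramCertZ_of_checkG (a := a) (b := b) C hM h
  simp only [checkG, Bool.and_eq_true, decide_eq_true_eq, beq_iff_eq, List.all_eq_true] at h
  obtain ⟨⟨⟨⟨⟨⟨⟨⟨⟨hQ, hK⟩, _⟩, hL⟩, _⟩, _⟩, _⟩, _⟩, _⟩, _⟩ := h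
  set n := L.length with hn
  let w : Fin n → ℂ := fun i => v (decode L[i])
  -- the quadratic form of the integer block is nonnegative on `w`
  have hA : 0 ≤ (∑ i, ∑ j, (starRingEnd ℂ) (w i) * (blockAG hz C.K C.c L i j : ℂ) * w j).re :=
    re_quadForm_nonneg_of_real _ (fun x => hG.quadForm_nonneg x) w
  -- the norm
  have hvv : star v ⬝ᵥ v = ∑ i : Fin n, (starRingEnd ℂ) (w i) * w i := by
    rw [dotProduct, ← Finset.sum_subset (Finset.subset_univ (sectorConfigs a b p q))
      (fun s _ hs => by rw [hv s (fun h => hs (mem_sectorConfigs.2 h)), mul_zero])]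
    rw [sum_sectorConfigs_eq_sum_fin_of_ok hL]
    rfl
  have hvv_re : (star v ⬝ᵥ v).re = ∑ i : Fin n, ‖w i‖ ^ 2 := by
    rw [hvv, Complex.re_sum]
    refine Finset.sum_congr rfl fun i _ => ?_
    rw [mul_comm, Complex.mul_conj, Complex.normSq_eq_norm_sq]
    norm_cast
  -- the quadratic form of `H`
  have hvHv : star v ⬝ᵥ (H *ᵥ v) =
      (∑ i : Fin n, ∑ j : Fin n, (starRingEnd ℂ) (w i) * (hz L[i] L[j] : ℂ) * w j) / ((Q : ℝ) : ℂ) := by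
    rw [dotProduct, ← Finset.sum_subset (Finset.subset_univ (sectorConfigs a b p q))
      (fun s _ hs => by rw [Pi.star_apply, hv s (fun h => hs (mem_sectorConfigs.2 h)), star_zero, zero_mul])]
    rw [sum_sectorConfigs_eq_sum_fin_of_ok hL, Finset.sum_div]
    refine Finset.sum_congr rfl fun i _ => ?_
    rw [mulVec, dotProduct, ← Finset.sum_subset (Finset.subset_univ (sectorConfigs a b p q))
      (fun s _ hs => by rw [hv s (fun h => hs (mem_sectorConfigs.2 h)), mul_zero])]
    rw [sum_sectorConfigs_eq_sum_fin_of_ok hL, Pi.star_apply, Finset.mul_sum, Finset.sum_div]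
    refine Finset.sum_congr rfl fun j _ => ?_
    have hci : code (decode L[i] : Finset (Orb (Fin a ×ₗ Fin b))) = L[i] :=
      code_decode (lt_of_mem_of_ok hL (List.getElem_mem i.isLt))
    have hcj : code (decode L[j] : Finset (Orb (Fin a ×ₗ Fin b))) = L[j] :=
      code_decode (lt_of_mem_of_ok hL (List.getElem_mem j.isLt))
    rw [hM.apply_eq, hci, hcj, Complex.ofReal_intCast, RCLike.star_def]
    ring
  have hQpos : (0 : ℝ) < (Q : ℝ) := by exact_mod_cast hQ
  have hvHv_re : (star v ⬝ᵥ (H *ᵥ v)).re =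
      (∑ i : Fin n, ∑ j : Fin n, (starRingEnd ℂ) (w i) * (hz L[i] L[j] : ℂ) * w j).re / (Q : ℝ) := by
    rw [hvHv, Complex.div_ofReal_re]
  -- expand the block: `K · (form of hz) − K c ‖w‖² ≥ 0`
  have hexp : (∑ i, ∑ j, (starRingEnd ℂ) (w i) * (blockAG hz C.K C.c L i j : ℂ) * w j).re =
      (C.K : ℝ) * (∑ i : Fin n, ∑ j : Fin n, (starRingEnd ℂ) (w i) * (hz L[i] L[j] : ℂ) * w j).re
        - (C.K : ℝ) * C.c * ∑ i : Fin n, ‖w i‖ ^ 2 := by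
    have hpt : ∀ i j : Fin n, (starRingEnd ℂ) (w i) * (blockAG hz C.K C.c L i j : ℂ) * w j =
        ((C.K : ℝ) : ℂ) * ((starRingEnd ℂ) (w i) * (hz L[i] L[j] : ℂ) * w j)
          - ((C.K : ℝ) : ℂ) * (C.c : ℂ) * ((starRingEnd ℂ) (w i) * (if i = j then 1 else 0) * w j) := by
      intro i j
      simp only [blockAG, Int.cast_mul, Int.cast_sub, Int.cast_natCast, Int.cast_ite, Int.cast_zero]
      push_cast
      split_ifs <;> ring
    simp_rw [hpt]
    rw [Finset.sum_congr rfl fun i _ => Finset.sum_sub_distrib _ _, Finset.sum_sub_distrib]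
    simp_rw [← Finset.mul_sum]
    have hdiag : (∑ i : Fin n, ∑ j : Fin n, (starRingEnd ℂ) (w i) * (if i = j then (1 : ℂ) else 0) * w j) =
        ((∑ i : Fin n, ‖w i‖ ^ 2 : ℝ) : ℂ) := by
      push_cast
      refine Finset.sum_congr rfl fun i _ => ?_
      rw [Finset.sum_eq_single i (fun j _ hj => by simp [Ne.symm hj]) (by simp), if_pos rfl, mul_one,
        mul_comm, Complex.mul_conj, Complex.normSq_eq_norm_sq]
      norm_cast
    rw [hdiag, Complex.sub_re, Complex.re_ofReal_mul, ← Complex.ofReal_intCast, ← Complex.ofReal_mul,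
      ← Complex.ofReal_mul, Complex.ofReal_re]
  rw [hexp] at hA
  have hK' : (0 : ℝ) < (C.K : ℝ) := by exact_mod_cast hK
  rw [hvv_re, hvHv_re, floor]
  have hcast : ((((C.c : ℚ) / (Q : ℚ)) : ℚ) : ℝ) = (C.c : ℝ) / (Q : ℝ) := by push_cast; ring
  rw [hcast, div_mul_eq_mul_div, div_le_div_iff_of_pos_right hQpos]
  nlinarith [hA, hK']

end KCert

end Sound

end OccupationCode

end Literature.MathematicalPhysics.QuantumLattice
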